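import Summits.QuantumAdvantage.QuantumAdvantage.Theorems.WbwObfuscatedGluedTreesKowGenVocabulary
import Literature.Computability.Complexity.CircuitClassesUniformProofs
import Literature.Computability.Complexity.LengthCompare
import Literature.Computability.Complexity.CodeFPBudgets
import Literature.Computability.Complexity.CodeFPArith
import Literature.Computability.Complexity.CircuitLowerBounds

/-!
# Toolkit for stub `stub_presentation` (part I): the circuit presentation of the neighbour predicate from `NbrBitFP`
# (`P ⊆ P/poly` + hard-wiring)  (crux `WbwObfuscatedGluedTrees`, stmt-QuantumAdvantage-2340;
# line `knowledge-of-walk-split`, stage 3, lead prover-line-stmt-QuantumAdvantage-2340-c2-0)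

Given an efficient obfuscator `O`, a scheme `P` whose neighbour predicate is polynomial-time ON CODES (`NbrBitFP P`,
inlined), and the three generic lemmas of the stage-3 skeleton as hypotheses (schedules, hard-wiring, code length),
part II (`…KowClearPresentation.lean`) EXHIBITS a master datum `D` with `GenAdmissible D O P`, `RefAdmissible D D.Γ O` and
depth `→ ∞`; this part I builds the PRESENTATION and proves it correct:

* the language `{z | f z = [true]}` of the `FP` witness `f` of `NbrBitFP` is in `P` (`mem_P_of_mem_FP`), hence decided
  by a polynomial-size family of `B₂`-circuits (`P_subset_PPoly_holds`);
* at level `ℓ` (PRF parameter `ℓ`, depth `ℓ + 1`, names of `N = 3ℓ + 5` bits) the code of the tuple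
  `(1^ℓ, 1^{ℓ+1}, k₀, k₁, k₂, k₃, x)` is `prefix ++ x` with the prefix depending on the keys only; hard-wire the prefix
  into the circuit of that input length (hypothesis F): the result computes `N_K` on the `2N` query wires, its size is
  bounded by a polynomial `ς ℓ` in `ℓ`, and its CODE LENGTH depends on `ℓ` and the key lengths only — so the obfuscator's
  coin demand at level `ℓ` is ONE number `c n = O.coinLen (…)` for all keys of full length;
* the key-part schedule `t` comes from hypothesis E with `p := ς` and `R :=` (coin-budget polynomial of `O`) ∘ (input
  length polynomial), giving clauses (1)–(4) and (8) of `GenAdmissible`; (5)–(7) are the bounds above.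

No hardness content; no new axiom. [folklore]
-/

set_option linter.dupNamespace false

noncomputable section

namespace Summit.QuantumAdvantage.QuantumAdvantage.Theorems.WbwObfuscatedGluedTrees.KnowledgeOfWalk.Generator

open Literature.Computability.Cryptography Literature.Computability.Complexity Filter Asymptotics
open Literature.Computability.Cryptography.ObfuscatedGluedTrees
open Literature.Computability.QuantumComplexity
open Literature.Computability.Complexity.CodeFP (natE unE bitE pairE strE)
open _root_.Computability (unaryEncodeNat encodeNat)

namespace Presentation

/-! ## The hypotheses of the stub, named -/

/-- `NbrBitFP P` (verbatim): the neighbour predicate is polynomial-time on codes (hypothesis of the stub, named;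
not a fact). -/
def NbrHyp (P : PuncturablePRFScheme) : Prop :=
  Literature.Computability.Complexity.CodeFP
    (pairE unE (pairE unE (pairE strE (pairE strE (pairE strE (pairE strE strE))))))
    bitE
    (fun t : ℕ × ℕ × List Bool × List Bool × List Bool × List Bool × List Bool =>
      if 1 ≤ t.2.1 then
        nbrBit (cycleOf P t.1 t.2.2.2.2.1 t.2.2.2.2.2.1 t.2.1) (naming P t.1 t.2.2.1 t.2.2.2.1 t.2.1)
          (fun i => t.2.2.2.2.2.2.getD (i : ℕ) false)
      else false)

/-- Statement of `stub_hardwire` (verbatim; a hypothesis of this construction — the landed `stub_hardwire` proves it;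
named here only to shorten binder types, not a cited fact). -/
def HardwireHyp : Prop :=
  ∀ (M m : ℕ) (ρ : Fin M → Option (Fin m)) (C : Literature.Computability.Complexity.Circuit (Fin M)), C.IsOver B2 →
    ∃ H : (Fin M → Bool) → Literature.Computability.Complexity.Circuit (Fin m),
      (∀ v, (H v).IsOver B2) ∧ (∀ v, (H v).size ≤ C.size + M) ∧
      (∀ v x, (H v).eval x = C.eval (fun i => (ρ i).elim (v i) x)) ∧
      (∀ v v', (encodeCircuit (H v)).length = (encodeCircuit (H v')).length)

/-! ## The language of the neighbour predicate and its circuits -/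

section Lang

variable {P : PuncturablePRFScheme}

/-- The `FP` witness of `NbrHyp`. [folklore] -/
def nbrF (hN : NbrHyp P) : List Bool → List Bool := Classical.choose hN

/-- Its specification. [folklore] -/
theorem nbrF_spec (hN : NbrHyp P) :
    nbrF hN ∈ FP ∧ ∀ t : ℕ × ℕ × List Bool × List Bool × List Bool × List Bool × List Bool,
      nbrF hN ((pairE unE (pairE unE (pairE strE (pairE strE (pairE strE (pairE strE strE)))))) t) =
        bitE (if 1 ≤ t.2.1 then
          nbrBit (cycleOf P t.1 t.2.2.2.2.1 t.2.2.2.2.2.1 t.2.1) (naming P t.1 t.2.2.1 t.2.2.2.1 t.2.1)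
            (fun i => t.2.2.2.2.2.2.getD (i : ℕ) false)
          else false) :=
  Classical.choose_spec hN

/-- The language `{z | f z = [true]}` of the witness. [folklore] -/
def lang (hN : NbrHyp P) : Language Bool := {z | nbrF hN z = [true]}

/-- It is in `P`: normalise the witness' output to one bit. [folklore] -/
theorem lang_mem_P (hN : NbrHyp P) : lang hN ∈ Classes.P := by
  -- `y ↦ [decide (y = [true])]` is FP
  have hG : CodeFP strE bitE (fun y : List Bool => decide (y = [true])) :=
    (CodeFP.eq (eα := strE) (fun _ _ h => h)).comp ((CodeFP.id strE).pair (CodeFP.const strE [true]))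
  obtain ⟨G, hGFP, hGspec⟩ := hG
  refine mem_P_of_mem_FP (g := G ∘ nbrF hN) (comp_mem_FP hGFP (nbrF_spec hN).1) (lang hN) fun w => ?_
  have hw : (G ∘ nbrF hN) w = [decide (nbrF hN w = [true])] := hGspec (nbrF hN w)
  refine ⟨fun h => ?_, fun h => ?_⟩
  · have h' : nbrF hN w = [true] := h
    rw [hw, h']; rfl
  · have h' : ¬ nbrF hN w = [true] := h
    rw [hw]; simp [h']

/-- Polynomial-size `B₂`-circuits for the language: the size polynomial … [folklore] -/
def sizePoly (hN : NbrHyp P) : Polynomial ℕ :=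
  Classical.choose (Set.mem_iUnion.1 (P_subset_PPoly_holds (lang_mem_P hN)))

/-- … and the family. [folklore] -/
def cfam (hN : NbrHyp P) : CircuitFamily :=
  Classical.choose (Classical.choose_spec (Set.mem_iUnion.1 (P_subset_PPoly_holds (lang_mem_P hN))))

/-- Specification of the family: `B₂`, size `≤ sizePoly`, decides the language. [folklore] -/
theorem cfam_spec (hN : NbrHyp P) :
    (∀ n, (cfam hN n).IsOver B2 ∧ (cfam hN n).size ≤ (sizePoly hN).eval n) ∧ (cfam hN).Decides (lang hN) :=
  Classical.choose_spec (Classical.choose_spec (Set.mem_iUnion.1 (P_subset_PPoly_holds (lang_mem_P hN))))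

/-- The family transported along an equality of input lengths. [folklore] -/
theorem cfam_eval_cast (hN : NbrHyp P) {n n' : ℕ} (h : n = n') (g : Fin n → Bool) (g' : Fin n' → Bool)
    (hg : ∀ j, g j = g' (Fin.cast h j)) : (cfam hN n).eval g = (cfam hN n').eval g' := by
  subst h
  have : g = g' := funext fun j => hg j
  rw [this]

end Lang

/-! ## The tuple code is a key-dependent prefix followed by the query bits -/

/-- The prefix of the code of `(1^μ, 1^d, k₀, k₁, k₂, k₃, x)` (everything but `x`). [folklore] -/
def pref (μ d : ℕ) (k₀ k₁ k₂ k₃ : List Bool) : List Bool :=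
  boolPair (unE μ) (boolPair (unE d) (boolPair k₀ (boolPair k₁ (boolPair k₂ (boolPair k₃ [])))))

/-- The code of the tuple is `pref ++ x`. [folklore] -/
theorem code_eq_pref_append (μ d : ℕ) (k₀ k₁ k₂ k₃ x : List Bool) :
    (pairE unE (pairE unE (pairE strE (pairE strE (pairE strE (pairE strE strE))))))
        (μ, d, k₀, k₁, k₂, k₃, x) = pref μ d k₀ k₁ k₂ k₃ ++ x := by
  simp [pref, boolPair, strE, List.append_assoc]

/-- Length of the prefix. [folklore] -/
theorem length_pref (μ d : ℕ) (k₀ k₁ k₂ k₃ : List Bool) :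
    (pref μ d k₀ k₁ k₂ k₃).length =
      2 * μ + 2 * d + 2 * k₀.length + 2 * k₁.length + 2 * k₂.length + 2 * k₃.length + 12 := by
  simp only [pref, length_boolPair, CodeFP.length_unE, List.length_nil]
  ring


/-! ## Level `ℓ`: arity, keys, the hard-wired circuit -/

/-- Name length at level `ℓ` (PRF parameter `ℓ`, depth `ℓ + 1`): `N = 3ℓ + 5`. [folklore] -/
def Nn (ℓ : ℕ) : ℕ := nameLen ℓ (ℓ + 1)

/-- Arity `2N` of the neighbour circuit at level `ℓ`. [folklore] -/
def ar (ℓ : ℕ) : ℕ := Nn ℓ + Nn ℓ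

/-- `2N = 6ℓ + 10`. [folklore] -/
theorem ar_eq (ℓ : ℕ) : ar ℓ = 6 * ℓ + 10 := by
  simp only [ar, Nn, nameLen, labelLen]; ring

/-- The `i`-th key at level `ℓ` (`= MasterData.keyℓ`). [folklore] -/
def kk (ℓ : ℕ) (K : List Bool) (i : ℕ) : List Bool := MasterData.keyℓ ℓ K i

/-- Keys have length `≤ ℓ`. [folklore] -/
theorem length_kk_le (ℓ : ℕ) (K : List Bool) (i : ℕ) : (kk ℓ K i).length ≤ ℓ := by
  simp [kk, MasterData.keyℓ]

/-- Keys cut from key material of full length `4ℓ` have length exactly `ℓ` (`i < 4`). [folklore] -/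
theorem length_kk_eq (ℓ : ℕ) {K : List Bool} (hK : K.length = 4 * ℓ) {i : ℕ} (hi : i < 4) :
    (kk ℓ K i).length = ℓ := by
  simp only [kk, MasterData.keyℓ, List.length_take, List.length_drop, hK]
  have : ℓ ≤ 4 * ℓ - i * ℓ := by
    have h3 : i * ℓ ≤ 3 * ℓ := Nat.mul_le_mul_right ℓ (by omega)
    omega
  exact min_eq_left this

/-- The key-dependent prefix of the tuple code at level `ℓ`. [folklore] -/
def prefK (ℓ : ℕ) (K : List Bool) : List Bool := pref ℓ (ℓ + 1) (kk ℓ K 0) (kk ℓ K 1) (kk ℓ K 2) (kk ℓ K 3)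

/-- The prefix has length `≤ 12ℓ + 14` … [folklore] -/
theorem length_prefK_le (ℓ : ℕ) (K : List Bool) : (prefK ℓ K).length ≤ 12 * ℓ + 14 := by
  rw [prefK, length_pref]
  have h0 := length_kk_le ℓ K 0; have h1 := length_kk_le ℓ K 1
  have h2 := length_kk_le ℓ K 2; have h3 := length_kk_le ℓ K 3
  omega

/-- … with equality for key material of full length. [folklore] -/
theorem length_prefK_eq (ℓ : ℕ) {K : List Bool} (hK : K.length = 4 * ℓ) : (prefK ℓ K).length = 12 * ℓ + 14 := by
  rw [prefK, length_pref, length_kk_eq ℓ hK (by norm_num : 0 < 4), length_kk_eq ℓ hK (by norm_num : 1 < 4),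
    length_kk_eq ℓ hK (by norm_num : 2 < 4), length_kk_eq ℓ hK (by norm_num : 3 < 4)]
  ring

/-- The input substitution: the last `2N` of `L + 2N` old inputs are the new inputs, the first `L` are constants.
[folklore] -/
def rho (ℓ L : ℕ) : Fin (L + ar ℓ) → Option (Fin (ar ℓ)) := fun j =>
  if h : L ≤ (j : ℕ) then some ⟨(j : ℕ) - L, by have := j.isLt; omega⟩ else none

section Circ

variable {P : PuncturablePRFScheme}

/-- The hard-wiring family at level `ℓ` and prefix length `L` (hypothesis F applied to the `P/poly` circuit of input
length `L + 2N`). [folklore] -/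
def hw (hN : NbrHyp P) (hF : HardwireHyp) (ℓ L : ℕ) :
    (Fin (L + ar ℓ) → Bool) → Literature.Computability.Complexity.Circuit (Fin (ar ℓ)) :=
  Classical.choose (hF (L + ar ℓ) (ar ℓ) (rho ℓ L) (cfam hN (L + ar ℓ)) ((cfam_spec hN).1 _).1)

/-- Its specification (the four clauses of hypothesis F). [folklore] -/
theorem hw_spec (hN : NbrHyp P) (hF : HardwireHyp) (ℓ L : ℕ) :
    (∀ v, (hw hN hF ℓ L v).IsOver B2) ∧ (∀ v, (hw hN hF ℓ L v).size ≤ (cfam hN (L + ar ℓ)).size + (L + ar ℓ)) ∧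
    (∀ v x, (hw hN hF ℓ L v).eval x = (cfam hN (L + ar ℓ)).eval (fun i => (rho ℓ L i).elim (v i) x)) ∧
    (∀ v v', (encodeCircuit (hw hN hF ℓ L v)).length = (encodeCircuit (hw hN hF ℓ L v')).length) :=
  Classical.choose_spec (hF (L + ar ℓ) (ar ℓ) (rho ℓ L) (cfam hN (L + ar ℓ)) ((cfam_spec hN).1 _).1)

/-- Code lengths of the family agree along an equality of prefix lengths. [folklore] -/
theorem hw_length_eq (hN : NbrHyp P) (hF : HardwireHyp) (ℓ : ℕ) {L L' : ℕ} (h : L = L')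
    (v : Fin (L + ar ℓ) → Bool) (v' : Fin (L' + ar ℓ) → Bool) :
    (encodeCircuit (hw hN hF ℓ L v)).length = (encodeCircuit (hw hN hF ℓ L' v')).length := by
  subst h
  exact (hw_spec hN hF ℓ L).2.2.2 v v'

/-- **The presentation**: the `P/poly` circuit of the right input length with the key-dependent prefix hard-wired.
[folklore] -/
def circ (hN : NbrHyp P) (hF : HardwireHyp) (ℓ : ℕ) (K : List Bool) :
    Literature.Computability.Complexity.Circuit (Fin (ar ℓ)) :=
  hw hN hF ℓ (prefK ℓ K).length (fun j => (prefK ℓ K).getD j false)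

/-- The presentation is a `B₂`-circuit. [folklore] -/
theorem circ_isOver (hN : NbrHyp P) (hF : HardwireHyp) (ℓ : ℕ) (K : List Bool) : (circ hN hF ℓ K).IsOver B2 :=
  (hw_spec hN hF ℓ _).1 _

/-- Reference code length at level `ℓ` (prefix length `12ℓ + 14`, all-zero constants). [folklore] -/
def codeLen₀ (hN : NbrHyp P) (hF : HardwireHyp) (ℓ : ℕ) : ℕ :=
  (encodeCircuit (hw hN hF ℓ (12 * ℓ + 14) (fun _ => false))).length

/-- For key material of full length the code length is the reference one. [folklore] -/
theorem length_encode_circ (hN : NbrHyp P) (hF : HardwireHyp) (ℓ : ℕ) {K : List Bool} (hK : K.length = 4 * ℓ) :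
    (encodeCircuit (circ hN hF ℓ K)).length = codeLen₀ hN hF ℓ :=
  hw_length_eq hN hF ℓ (length_prefK_eq ℓ hK) _ _

/-- **Correctness**: the presentation computes the neighbour predicate `N_K` at level `ℓ`. [folklore] -/
theorem circ_eval (hN : NbrHyp P) (hF : HardwireHyp) (ℓ : ℕ) (K : List Bool) (x : Fin (ar ℓ) → Bool) :
    (circ hN hF ℓ K).eval x =
      nbrBit (cycleOf P ℓ (kk ℓ K 2) (kk ℓ K 3) (ℓ + 1)) (naming P ℓ (kk ℓ K 0) (kk ℓ K 1) (ℓ + 1)) x := by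
  set L := (prefK ℓ K).length with hL
  set z : List Bool := prefK ℓ K ++ List.ofFn x with hz
  have hzl : L + ar ℓ = z.length := by simp [hz, hL]
  -- the hard-wired circuit evaluates the `P/poly` circuit on the bits of `z`
  have hget : z.get = fun i : Fin z.length => z.getD (i : ℕ) false := funext fun i => by
    rw [List.getD_eq_getElem _ _ i.isLt]; simp
  have h1 : (circ hN hF ℓ K).eval x = (cfam hN z.length).eval z.get := by
    rw [circ, (hw_spec hN hF ℓ L).2.2.1, hget]
    refine cfam_eval_cast hN hzl _ _ fun j => ?_
    simp only [Fin.val_cast]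
    by_cases hj : L ≤ (j : ℕ)
    · have hj' : (j : ℕ) - L < ar ℓ := by have := j.isLt; omega
      simp only [rho, hj, dif_pos, Option.elim]
      rw [hz, List.getD_append_right _ _ _ _ (by omega), List.getD_eq_getElem _ _ (by simpa using hj'),
        List.getElem_ofFn]
    · push Not at hj
      simp only [rho, not_le.2 hj, dif_neg, not_false_eq_true, Option.elim]
      rw [hz, List.getD_append _ _ _ _ (by omega)]
  -- the family decides the language of the `FP` witness
  have h2 : (cfam hN z.length).eval z.get = (lang hN).boolIndicator z := (cfam_spec hN).2 z
  -- the witness on `z = code (ℓ, ℓ+1, keys, x)`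
  have h3 : nbrF hN z = bitE (nbrBit (cycleOf P ℓ (kk ℓ K 2) (kk ℓ K 3) (ℓ + 1))
      (naming P ℓ (kk ℓ K 0) (kk ℓ K 1) (ℓ + 1)) x) := by
    have := (nbrF_spec hN).2 (ℓ, ℓ + 1, kk ℓ K 0, kk ℓ K 1, kk ℓ K 2, kk ℓ K 3, List.ofFn x)
    dsimp only at this
    rw [code_eq_pref_append, if_pos (Nat.le_add_left 1 ℓ)] at this
    have hx : (fun i : Fin (nameLen ℓ (ℓ + 1) + nameLen ℓ (ℓ + 1)) => (List.ofFn x).getD (i : ℕ) false) = x := by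
      funext i
      rw [List.getD_eq_getElem _ _ (by rw [List.length_ofFn]; exact i.isLt), List.getElem_ofFn]
      rfl
    rw [hx] at this
    rw [hz, prefK]
    exact this
  rw [h1, h2]
  cases hb : nbrBit (cycleOf P ℓ (kk ℓ K 2) (kk ℓ K 3) (ℓ + 1)) (naming P ℓ (kk ℓ K 0) (kk ℓ K 1) (ℓ + 1)) x
  · rw [← Bool.not_eq_true, ← Set.mem_iff_boolIndicator]
    show ¬ nbrF hN z = [true]
    rw [h3, hb]; simp [bitE]
  · rw [← Set.mem_iff_boolIndicator]
    show nbrF hN z = [true]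
    rw [h3, hb]; rfl

end Circ

end Presentation

/-- **Registered toolkit stub `toolkit_presentation`** (landing ticket of this toolkit file): evaluation of an
`ℕ`-polynomial is monotone (the tree's `natPoly_eval_mono`, re-exported under the registered name) — used for every size /
code-length / coin bound of the presentation. [folklore] -/
theorem toolkit_presentation :
    ∀ (p : Polynomial ℕ) (a b : ℕ), a ≤ b → p.eval a ≤ p.eval b :=
  fun p _ _ h => natPoly_eval_mono p h

end Summit.QuantumAdvantage.QuantumAdvantage.Theorems.WbwObfuscatedGluedTrees.KnowledgeOfWalk.Generator

end
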